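import Literature.NumberTheory.EllipticCurves.CasselsTateSelmerPullback
import Literature.GroupTheory.FiniteAbelian.AlternatingPairing
import HarnessLib

/-!
# The level-`p^k` Cassels–Tate pairing on the WHOLE `p`-primary part `Ш(E/K)[p^∞]`: a definition-level,
# alternating, NON-DEGENERATE pairing as soon as `p^k` kills `Ш(E/K)[p^∞]`

Topic `NumberTheory/EllipticCurves`; namespace `Literature.NumberTheory.EllipticCurves`. Theorems only:
**no definition, no named fact** (D-0026). Companion of `CasselsTateLevelAssembly` (the level-`m` pairing
`ctLevelPairing` on `Ш(E/K)[m]`, Milne *ADT* I Prop. 6.9, and its LEVEL property `IsLevelPairing m`: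
alternating, kernel `Ш[m] ∩ mШ` — Milne I Thm. 6.13(a) with Lemma 6.17) and of `CasselsTateSelmerPullback` /
`CasselsTateSelmerLocalValue` / `CasselsTateSelmerKolyvaginValue` (its Selmer pull-back and McCallum's
Prop. 4.7 value formula).

Kolyvagin-type arguments at a prime `p` (McCallum 1991 §5; at `p = 2` in the CM frame of Hu–Shu–Yin:
crux `UpperOffV0HSYPlus`, the coupled Cassels–Tate telescope `Summits/…/SylvesterTwoHeegnerIndexCoupledTelescope*`)
use THE Cassels–Tate pairing on the finite group `Ш(E/K)[p^∞]` as a NON-DEGENERATE alternating form (to choose a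
Lagrangian and count `#Ш[p^∞] = (#D)²`) TOGETHER WITH its value on Kolyvagin classes.  The value formula is
a tree result about the CONSTRUCTED pairing `ctLevelPairing` (not about an anonymous `∃ B`), so the
non-degenerate form must be supplied for the same object.  This file does exactly that, by pure level-pairing algebra:

* §1 (any abelian group `G`, any `p`, `k`): `torsionBy_le_primaryComponent` (`G[p^k] ≤ G[p^∞]`);
  under `hk : p^k` kills `G[p^∞]` — `primaryComponent_le_torsionBy`, `primaryComponent_eq_torsionBy`
  (`G[p^∞] = G[p^k]`), `zsmul_eq_zero_of_mul_zsmul_eq_zero` (the `hL`-shape «`p^{2k} a = 0 → p^k a = 0`»),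
  `pow_nsmul_primaryComponent_eq_zero_of_le` (monotone in `k`); for a finite `G[p^∞]` such a `k` exists
  (`exists_pow_nsmul_primaryComponent_eq_zero`) — so `hk` is a hypothesis or comes from `Finite`, never
  an axiom;
* §2 (`G` torsion, `p` prime, `B : G[p^k] →+ G[p^k] →+ T` a level pairing, `hk`):
  `IsLevelPairing.eq_zero_of_forall_left` / `_right` — `B` is NON-DEGENERATE on `G[p^k]` (an element of
  `G[p^k] ∩ p^k G` is `p^k z` with `z` torsion; the prime-to-`p` part `b` of the order of `z` gives
  `b • x = p^k • (b • z) = 0` with `b • z ∈ G[p^∞]`, and `gcd(b, p^k) = 1`); `IsLevelPairing.eq_neg`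
  (antisymmetry); and the TRANSPORT to `AddCommGroup.primaryComponent G p` along the equality of §1:
  `IsLevelPairing.exists_primaryComponent_pairing` — a bi-additive `B₂` on `G[p^∞]` with
  `B₂ a b = B a b`, alternating, antisymmetric, both kernels trivial;
* §3 (an elliptic curve `E = W` over a number field, `Ш(E/K)` torsion by `isTorsion_sha`):
  `exists_primaryComponent_pairing_of_isLevelPairing` (any level pairing on `Ш[p^k]`), and for Milne's
  recipe `exists_primaryComponent_ctLevelPairing` — **a bi-additive, alternating, antisymmetric,
  NON-DEGENERATE `B₂ : Ш(E/K)[p^∞] × Ш(E/K)[p^∞] → ℚ/ℤ` whose value at `(a, b)` IS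
  `zmodToCircle (p^{2k}) (ctGeneralFun … a b)`**, granted `IsLevelPairing (p^k) (ctLevelPairing …)` (the
  tree's `isLevelPairing_ctLevelPairing_of_inputs`; for THE canonical invariant maps all its inputs are tree
  theorems, see `Summits/…/GenusKolyvaginAtTwoCasselsTatePTcRealReadout`) and `p^k Ш[p^∞] = 0`; plus
  `sha_hL_of_pow_kills` — the hypothesis `hL` («`Ш[m²] ⊆ Ш[m]`», `m = p^k`) of `exists_selmerToShaTorsion`;
* §4 `exists_selmerToPrimaryComponent` — the pull-back map `ι₂ : Sel^{(m²)}(E/K) →+ Ш(E/K)[p^∞]` over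
  `torsionH1ToH1` with its kernel criterion, and `exists_bridge_ctLevelPairing` — `B₂ (ι₂ z) (ι₂ t)` IS the
  tree's `ctLevelPairing … (ι z) (ι t)` for an `ι` satisfying the hypothesis `hι` of the three value files;

So a consumer displaying `(B_X, D_X)` on `AddCommGroup.primaryComponent (Ш X) p` and a Selmer pairing `P_X`
with VALUE leaves can take BOTH from `ctLevelPairing`: `B_X := B₂` (§3) and `P_X s t := (B₂ (ι₂ s) (ι₂ t),
B₂ (ι₂ s) (w (ι₂ t)))` (§4; as a bi-additive map: `AddMonoidHom.mk' (fun s ↦ (B s).prod ((B s).comp w)) …`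
pulled back along `ι₂`), values by `ctLevelPairing_pullback_eq_localTerm_kolyvagin` through the bridge.
What this file does NOT supply: the `𝒪`-balance of `ctLevelPairing` under a CM automorphism (Milne I
Rem. 6.10(a) at definition level) and the restriction/corestriction projection formula (Fisher 2003
Prop. 2.16 at definition level) — neither is in the tree for the constructed pairing.
Nothing curve-specific is proved; BSD is not advanced.

## References

* [MilneADT2006] J. S. Milne, *Arithmetic Duality Theorems*, 2nd ed. (2006), Ch. I §6: Prop. 6.9,
  Lemma 6.17, Thm. 6.13(a) (kernel of the pairing on `Ш[m]`), Cor. 6.24 / Rem. 6.10.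
* [McCallumLMS1991] W. G. McCallum, *Kolyvagin's work on Shafarevich–Tate groups*, LMS Lecture Note
  Ser. 153 (1991), §5, proof of Thm. 5.4 (p. 288: the non-degenerate alternating pairing on `Ш(E/K)_{p^∞}`
  and a maximal isotropic subgroup).
* [SilvermanAEC2009] J. H. Silverman, *The Arithmetic of Elliptic Curves*, 2nd ed., Thm. X.4.14.
-/

noncomputable section

open scoped Classical AddSubgroup

universe u v

namespace Literature.NumberTheory.EllipticCurves

open Literature.GroupTheory.FiniteAbelian

/-! ## §1. `G[p^k] ≤ G[p^∞]`, and equality when `p^k` kills `G[p^∞]` -/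

section Primary

variable {G : Type u} [AddCommGroup G] (p k : ℕ)

/-- `G[p^k] ≤ G[p^∞]`: an element killed by `p^k` lies in the `p`-primary component.
[cite: Fuchs1970, §1 (p. 10: A[n]) and §8 Thm. 8.4 (p. 47: the p-components A_p)] -/
theorem torsionBy_le_primaryComponent : G[(p ^ k : ℕ)] ≤ AddCommGroup.primaryComponent G p := by
  intro x hx
  exact (AddCommGroup.mem_primaryComponent).2 ⟨k, AddSubgroup.torsionBy.nsmul_iff.mp hx⟩

variable {p k}

/-- If `p^k` kills the `p`-primary component then `G[p^∞] ≤ G[p^k]`.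
[cite: Fuchs1970, §1 (p. 10: A[n]) and §8 Thm. 8.4 (p. 47: the p-components A_p)] -/
theorem primaryComponent_le_torsionBy (hk : ∀ x ∈ AddCommGroup.primaryComponent G p, p ^ k • x = 0) :
    AddCommGroup.primaryComponent G p ≤ G[(p ^ k : ℕ)] := fun x hx ↦
  AddSubgroup.torsionBy.nsmul_iff.mpr (hk x hx)

/-- If `p^k` kills the `p`-primary component then `G[p^∞] = G[p^k]` as subgroups of `G`.
[cite: Fuchs1970, §1 (p. 10: A[n]) and §8 Thm. 8.4 (p. 47: the p-components A_p)] -/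
theorem primaryComponent_eq_torsionBy (hk : ∀ x ∈ AddCommGroup.primaryComponent G p, p ^ k • x = 0) :
    AddCommGroup.primaryComponent G p = G[(p ^ k : ℕ)] :=
  le_antisymm (primaryComponent_le_torsionBy hk) (torsionBy_le_primaryComponent p k)

/-- If `p^k` kills `G[p^∞]`, then every element of `G` killed by `p^k · p^k` is killed by `p^k` (it lies in
`G[p^∞]`): the hypothesis `hL` of `exists_selmerToShaTorsion` at `m = p^k`.
[cite: Fuchs1970, §1 (p. 10: A[n]) and §8 Thm. 8.4 (p. 47: the p-components A_p)] -/
theorem zsmul_eq_zero_of_mul_zsmul_eq_zero (hk : ∀ x ∈ AddCommGroup.primaryComponent G p, p ^ k • x = 0)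
    {a : G} (ha : (((p ^ k * p ^ k : ℕ) : ℤ)) • a = 0) : ((p ^ k : ℕ) : ℤ) • a = 0 := by
  rw [natCast_zsmul] at ha ⊢
  refine hk a ((AddCommGroup.mem_primaryComponent).2 ⟨k + k, ?_⟩)
  rwa [pow_add]

/-- If `p^k₀` kills `G[p^∞]`, so does `p^k` for `k₀ ≤ k`.
[cite: Fuchs1970, §6 Example 4 (p. 31: n-bounded groups) and §8 Thm. 8.4 (p. 47)] -/
theorem pow_nsmul_primaryComponent_eq_zero_of_le {k₀ : ℕ}
    (hk₀ : ∀ x ∈ AddCommGroup.primaryComponent G p, p ^ k₀ • x = 0) (hle : k₀ ≤ k) :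
    ∀ x ∈ AddCommGroup.primaryComponent G p, p ^ k • x = 0 := fun x hx ↦ by
  obtain ⟨d, rfl⟩ := Nat.exists_eq_add_of_le hle
  rw [pow_add, mul_comm, mul_smul, hk₀ x hx, smul_zero]

variable (p) in
/-- A finite `p`-primary component is killed by some `p^k` (it is a bounded `p`-group).
[cite: Fuchs1970, §6 Example 4 (p. 31: n-bounded groups) and §8 Thm. 8.4 (p. 47)] -/
theorem exists_pow_nsmul_primaryComponent_eq_zero [Finite (AddCommGroup.primaryComponent G p)] :
    ∃ k : ℕ, ∀ x ∈ AddCommGroup.primaryComponent G p, p ^ k • x = 0 := by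
  haveI : Fintype (AddCommGroup.primaryComponent G p) := Fintype.ofFinite _
  -- each element has its own exponent; take the maximum over the finite group
  have hx : ∀ x : AddCommGroup.primaryComponent G p, ∃ j : ℕ, p ^ j • (x : G) = 0 := fun x ↦
    (AddCommGroup.mem_primaryComponent).1 x.2
  choose j hj using hx
  refine ⟨Finset.univ.sup j, fun x hx' ↦ ?_⟩
  have hle : j ⟨x, hx'⟩ ≤ Finset.univ.sup j := Finset.le_sup (Finset.mem_univ _)
  obtain ⟨d, hd⟩ := Nat.exists_eq_add_of_le hle
  rw [hd, pow_add, mul_comm, mul_smul, hj ⟨x, hx'⟩, smul_zero]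

end Primary

/-! ## §2. A level pairing at `p^k` is non-degenerate when `p^k` kills `G[p^∞]` (`G` torsion) -/

section Level

variable {G : Type u} [AddCommGroup G] {T : Type v} [AddCommGroup T] {p k : ℕ}
  {B : G[(p ^ k : ℕ)] →+ G[(p ^ k : ℕ)] →+ T}

/-- **Non-degeneracy on the left.** Let `G` be a torsion group, `p` a prime, and suppose `p^k` kills
`G[p^∞]`.  If `B` is a LEVEL pairing on `G[p^k]` (kernel `G[p^k] ∩ p^k G`, Milne I Thm. 6.13(a) at level
`p^k`), then its left kernel is trivial: `x = p^k z` with `z` of order `p^a b`, `p ∤ b`, gives `b z ∈ G[p^∞]`,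
so `b x = p^k (b z) = 0`, and `p^k x = 0`, `gcd(b, p^k) = 1` force `x = 0`.
[cite: MilneADT2006, Ch. I §6, Thm. 6.13(a) and Lemma 6.17] -/
theorem _root_.Literature.GroupTheory.FiniteAbelian.IsLevelPairing.eq_zero_of_forall_left
    (hB : IsLevelPairing (p ^ k) B) (hp : p.Prime) (htors : AddMonoid.IsTorsion G)
    (hk : ∀ x ∈ AddCommGroup.primaryComponent G p, p ^ k • x = 0)
    (x : G[(p ^ k : ℕ)]) (hx : ∀ y, B x y = 0) : x = 0 := by
  obtain ⟨z, hz⟩ := (hB.2 x).1 hx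
  -- the order of `z` and its prime-to-`p` part
  obtain ⟨n, hn, hnz⟩ := (htors z).exists_nsmul_eq_zero
  obtain ⟨a, b, hb, rfl⟩ := Nat.exists_eq_pow_mul_and_not_dvd hn.ne' p hp.one_lt.ne'
  have hbz : b • z ∈ AddCommGroup.primaryComponent G p :=
    (AddCommGroup.mem_primaryComponent).2 ⟨a, by rw [← mul_nsmul', ← hnz]⟩
  have hbx : b • (x : G) = 0 := by
    rw [← hz, ← mul_nsmul', mul_comm, mul_nsmul', hk _ hbz]
  have hpx : p ^ k • (x : G) = 0 := AddSubgroup.torsionBy.nsmul_iff.mp x.2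
  have hcop : b.Coprime p := (Nat.coprime_comm.mp ((Nat.Prime.coprime_iff_not_dvd hp).2 hb))
  exact Subtype.ext (eq_zero_of_pow_nsmul_of_coprime_nsmul hpx hcop hbx)

/-- **Non-degeneracy on the right** (antisymmetry + the left statement).
[cite: MilneADT2006, Ch. I §6, Thm. 6.13(a)] -/
theorem _root_.Literature.GroupTheory.FiniteAbelian.IsLevelPairing.eq_zero_of_forall_right
    (hB : IsLevelPairing (p ^ k) B) (hp : p.Prime) (htors : AddMonoid.IsTorsion G)
    (hk : ∀ x ∈ AddCommGroup.primaryComponent G p, p ^ k • x = 0)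
    (y : G[(p ^ k : ℕ)]) (hy : ∀ x, B x y = 0) : y = 0 :=
  hB.eq_zero_of_forall_left hp htors hk y fun x ↦ by rw [eq_neg_of_alternating B hB.1, hy, neg_zero]

/-- **Transport to `G[p^∞]`.** Under the hypotheses of `IsLevelPairing.eq_zero_of_forall_left`, the level
pairing `B` on `G[p^k] = G[p^∞]` IS a bi-additive pairing `B₂` on `AddCommGroup.primaryComponent G p` with the
same values, alternating, antisymmetric, and with BOTH kernels trivial.
[cite: MilneADT2006, Ch. I §6, Thm. 6.13(a)] [cite: McCallumLMS1991, §5, proof of Thm. 5.4 (p. 288)] -/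
theorem _root_.Literature.GroupTheory.FiniteAbelian.IsLevelPairing.exists_primaryComponent_pairing
    (hB : IsLevelPairing (p ^ k) B) (hp : p.Prime) (htors : AddMonoid.IsTorsion G)
    (hk : ∀ x ∈ AddCommGroup.primaryComponent G p, p ^ k • x = 0) :
    ∃ B₂ : AddCommGroup.primaryComponent G p →+ AddCommGroup.primaryComponent G p →+ T,
      (∀ a b, B₂ a b = B ⟨a, primaryComponent_le_torsionBy hk a.2⟩ ⟨b, primaryComponent_le_torsionBy hk b.2⟩) ∧
      (∀ a, B₂ a a = 0) ∧ (∀ a b, B₂ b a = -(B₂ a b)) ∧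
      (∀ a, (∀ b, B₂ a b = 0) → a = 0) ∧ (∀ b, (∀ a, B₂ a b = 0) → b = 0) := by
  -- the inclusion `G[p^∞] →+ G[p^k]` (an isomorphism of subgroups, `primaryComponent_eq_torsionBy`)
  let ι : AddCommGroup.primaryComponent G p →+ G[(p ^ k : ℕ)] :=
    AddSubgroup.inclusion (primaryComponent_le_torsionBy hk)
  have hι : ∀ a, ι a = ⟨a, primaryComponent_le_torsionBy hk a.2⟩ := fun _ ↦ rfl
  have hιsurj : ∀ y : G[(p ^ k : ℕ)], ∃ b, ι b = y := fun y ↦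
    ⟨⟨y, torsionBy_le_primaryComponent p k y.2⟩, Subtype.ext rfl⟩
  refine ⟨(B.comp ι).compl₂ ι, fun a b ↦ rfl, fun a ↦ hB.1 _, fun a b ↦ ?_, fun a ha ↦ ?_, fun b hb ↦ ?_⟩
  · change B (ι b) (ι a) = -(B (ι a) (ι b))
    rw [eq_neg_of_alternating B hB.1]
  · have h0 : ι a = 0 := hB.eq_zero_of_forall_left hp htors hk (ι a) fun y ↦ by
      obtain ⟨b, rfl⟩ := hιsurj y
      exact ha b
    exact AddSubgroup.inclusion_injective _ (h0.trans (map_zero ι).symm)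
  · have h0 : ι b = 0 := hB.eq_zero_of_forall_right hp htors hk (ι b) fun x ↦ by
      obtain ⟨a, rfl⟩ := hιsurj x
      exact hb a
    exact AddSubgroup.inclusion_injective _ (h0.trans (map_zero ι).symm)

end Level

/-! ## §3. `Ш(E/K)[p^∞]`: any level pairing, and Milne's `ctLevelPairing` -/

section Sha

open _root_.WeierstrassCurve Field NumberField Function
open Literature.NumberTheory.GaloisRepresentations Literature.NumberTheory.GaloisCohomology
open Literature.NumberTheory.GaloisRepresentations.DiscreteGaloisModule (mu MuCarrier)

variable {K : Type u} [Field K] [NumberField K] (W : WeierstrassCurve K)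

/-- **Any level pairing on `Ш(E/K)[p^k]`, `p^k` killing `Ш(E/K)[p^∞]`, is a non-degenerate alternating
pairing on `Ш(E/K)[p^∞]`** (`Ш(E/K)` is torsion: `isTorsion_sha`).
[cite: MilneADT2006, Ch. I §6, Thm. 6.13(a)] [cite: McCallumLMS1991, §5, proof of Thm. 5.4 (p. 288)] -/
theorem exists_primaryComponent_pairing_of_isLevelPairing {T : Type v} [AddCommGroup T] {p k : ℕ}
    (hp : p.Prime) (B : (W.sha)[(p ^ k : ℕ)] →+ (W.sha)[(p ^ k : ℕ)] →+ T) (hB : IsLevelPairing (p ^ k) B)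
    (hk : ∀ x ∈ AddCommGroup.primaryComponent W.sha p, p ^ k • x = 0) :
    ∃ B₂ : AddCommGroup.primaryComponent W.sha p →+ AddCommGroup.primaryComponent W.sha p →+ T,
      (∀ a b, B₂ a b = B ⟨a, primaryComponent_le_torsionBy hk a.2⟩ ⟨b, primaryComponent_le_torsionBy hk b.2⟩) ∧
      (∀ a, B₂ a a = 0) ∧ (∀ a b, B₂ b a = -(B₂ a b)) ∧
      (∀ a, (∀ b, B₂ a b = 0) → a = 0) ∧ (∀ b, (∀ a, B₂ a b = 0) → b = 0) :=
  hB.exists_primaryComponent_pairing hp W.isTorsion_sha hk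

/-- The `hL` hypothesis of `exists_selmerToShaTorsion` at `m = p^k` («`Ш[m²] ⊆ Ш[m]`») from
`p^k Ш(E/K)[p^∞] = 0` (McCallum's setting: `p^{M₀}` annihilates `Ш(E/K)_{p^∞}`, classes at level `p^M`,
`M = 2M₀`). [cite: McCallumLMS1991, §5, proof of Thm. 5.4 (p. 288)] [cite: Fuchs1970, §8 Thm. 8.4 (p. 47)] -/
theorem sha_hL_of_pow_kills {p k : ℕ} (hk : ∀ x ∈ AddCommGroup.primaryComponent W.sha p, p ^ k • x = 0) :
    ∀ a ∈ W.sha, (((p ^ k * p ^ k : ℕ) : ℤ)) • a = 0 → ((p ^ k : ℕ) : ℤ) • a = 0 := by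
  intro a ha hma
  have h := zsmul_eq_zero_of_mul_zsmul_eq_zero (G := W.sha) hk (a := ⟨a, ha⟩)
    (Subtype.ext (by simpa using hma))
  simpa using congrArg Subtype.val h

variable (m : ℕ) [NeZero m]
variable (e : geomTorsion W ((m * m : ℕ) : ℤ) → geomTorsion W ((m * m : ℕ) : ℤ) → AlgebraicClosure K)
  (hμ : ∀ S T, e S T ^ (m * m) = 1)
  (hadd₁ : ∀ S₁ S₂ T, e (S₁ + S₂) T = e S₁ T * e S₂ T)
  (hadd₂ : ∀ S T₁ T₂, e S (T₁ + T₂) = e S T₁ * e S T₂)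
  (hgal : ∀ (σ : absoluteGaloisGroup K) (S T : geomTorsion W ((m * m : ℕ) : ℤ)),
    σ • e S T = e (σ • S) (σ • T))
variable (inv : LocalInvariants K (m * m))
variable (halt : ∀ T, e T T = 1) (hPT' : inv.SumInvLocalizationEqZero)
  (hH3 : ∀ c : galoisCohomology (mu K (m * m)) 3,
    (∀ v : Place K, galoisCohomology.localization (mu K (m * m)) v 3 c = 0) → c = 0)
  (hfin : ∀ D : GeneralCaseData W m e hμ hadd₁ hadd₂ hgal, ∃ S : Finset (Place K),
    ∀ v ∉ S, D.localTerm inv v = 0)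

/-- **Milne's level-`p^k` Cassels–Tate pairing on the whole `Ш(E/K)[p^∞]`.** Let `m = p^k` kill
`Ш(E/K)[p^∞]` and let `ctLevelPairing W m e … inv …` be a LEVEL pairing on `Ш(E/K)[m]` (the tree's
`isLevelPairing_ctLevelPairing_of_inputs`; all inputs are theorems for the canonical invariant maps).  Then
there is a bi-additive `B₂ : Ш(E/K)[p^∞] × Ш(E/K)[p^∞] → ℚ/ℤ` with
`B₂ a b = zmodToCircle (m²) (ctGeneralFun W m e … inv a b)` — THE constructed value — alternating,
antisymmetric and NON-DEGENERATE (both kernels trivial).  Its Selmer pull-back and values on Kolyvagin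
classes are `ctLevelPairing_pullback_apply` / `ctLevelPairing_pullback_eq_localTerm_kolyvagin` (with
`hL := sha_hL_of_pow_kills`). [cite: MilneADT2006, Ch. I §6, Prop. 6.9, Thm. 6.13(a)]
[cite: McCallumLMS1991, §5, proof of Thm. 5.4 (p. 288)] -/
theorem exists_primaryComponent_ctLevelPairing [W.IsElliptic] {p k : ℕ} (hp : p.Prime) (hm : m = p ^ k)
    (hLP : IsLevelPairing m (ctLevelPairing W m e hμ hadd₁ hadd₂ hgal inv halt hPT' hH3 hfin))
    (hk : ∀ x ∈ AddCommGroup.primaryComponent W.sha p, p ^ k • x = 0) :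
    ∃ (hle : AddCommGroup.primaryComponent W.sha p ≤ (W.sha)[m])
      (B₂ : AddCommGroup.primaryComponent W.sha p →+ AddCommGroup.primaryComponent W.sha p →+
        AddCircle (1 : ℚ)),
      (∀ a b, B₂ a b = ctLevelPairing W m e hμ hadd₁ hadd₂ hgal inv halt hPT' hH3 hfin
        ⟨a, hle a.2⟩ ⟨b, hle b.2⟩) ∧
      (∀ a b, B₂ a b = zmodToCircle (m * m) (ctGeneralFun W m e hμ hadd₁ hadd₂ hgal inv
        ((a : W.sha) : W.galH1) ((b : W.sha) : W.galH1))) ∧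
      (∀ a, B₂ a a = 0) ∧ (∀ a b, B₂ b a = -(B₂ a b)) ∧
      (∀ a, (∀ b, B₂ a b = 0) → a = 0) ∧ (∀ b, (∀ a, B₂ a b = 0) → b = 0) := by
  subst hm
  obtain ⟨B₂, hval, halt₂, hanti, hl, hr⟩ :=
    exists_primaryComponent_pairing_of_isLevelPairing W hp _ hLP hk
  exact ⟨primaryComponent_le_torsionBy hk, B₂, hval, fun a b ↦ by rw [hval, ctLevelPairing_apply],
    halt₂, hanti, hl, hr⟩

/-! ## §4. The Selmer pull-back INTO `Ш(E/K)[p^∞]` and the bridge to the tree's value theorems -/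

/-- **The map `Sel^{(m²)}(E/K) → Ш(E/K)[p^∞]`** (`m = p^k` killing `Ш(E/K)[p^∞]`): `z ↦` the image of `z`
in `H¹(K, E)` — the tree's `exists_selmerToShaTorsion` (into `Ш[m]`, `hL := sha_hL_of_pow_kills`) followed by
`Ш[m] ≤ Ш[p^∞]`; with its kernel criterion (`z` dies in `H¹(K, E)`, i.e. comes from `E(K)/m²`).
[cite: MilneADT2006, Ch. I §6, (6.14) and Prop. 6.9] -/
theorem exists_selmerToPrimaryComponent {p k : ℕ} (hp : p.Prime)
    (hk : ∀ x ∈ AddCommGroup.primaryComponent W.sha p, p ^ k • x = 0) :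
    ∃ ι₂ : selmerGroup W ((p ^ k * p ^ k : ℕ) : ℤ) →+ AddCommGroup.primaryComponent W.sha p,
      (∀ z, (((ι₂ z : AddCommGroup.primaryComponent W.sha p) : W.sha) : W.galH1) =
        torsionH1ToH1 W ((p ^ k * p ^ k : ℕ) : ℤ) z) ∧
      (∀ z, ι₂ z = 0 ↔ torsionH1ToH1 W ((p ^ k * p ^ k : ℕ) : ℤ) z = 0) := by
  haveI : NeZero (p ^ k) := ⟨pow_ne_zero _ hp.ne_zero⟩
  obtain ⟨ι, hι⟩ := exists_selmerToShaTorsion W (p ^ k) (sha_hL_of_pow_kills W hk)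
  let j : (W.sha)[(p ^ k : ℕ)] →+ AddCommGroup.primaryComponent W.sha p :=
    AddSubgroup.inclusion (torsionBy_le_primaryComponent (G := W.sha) p k)
  refine ⟨j.comp ι, fun z ↦ hι z, fun z ↦ ?_⟩
  rw [← selmerToShaTorsion_eq_zero_iff ι hι z]
  change j (ι z) = 0 ↔ ι z = 0
  constructor
  · intro h
    exact AddSubgroup.inclusion_injective _ (h.trans (map_zero j).symm)
  · intro h
    rw [h, map_zero]

/-- **Bridge to the tree's value theorems.** For the `B₂` of `exists_primaryComponent_ctLevelPairing` and
ANY `ι₂ : Sel^{(m²)} →+ Ш[p^∞]` over `torsionH1ToH1` (`exists_selmerToPrimaryComponent`), the composite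
`ι := (Ш[p^∞] ≤ Ш[m]) ∘ ι₂ : Sel^{(m²)} →+ Ш[m]` satisfies the hypothesis `hι` of
`CasselsTateSelmer{Pullback,LocalValue,KolyvaginValue}` and `B₂ (ι₂ z) (ι₂ t) = ctLevelPairing … (ι z) (ι t)`;
so `ctLevelPairing_pullback_eq_localTerm(_kolyvagin)` / `_ne_zero_iff_localTerm(_kolyvagin)` (McCallum's
Prop. 4.7 shape) compute `B₂ (ι₂ z) (ι₂ t)` VERBATIM. [cite: McCallumLMS1991, §4 Prop. 4.7]
[cite: MilneADT2006, Ch. I §6, Prop. 6.9] -/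
theorem exists_bridge_ctLevelPairing [W.IsElliptic] {p : ℕ}
    (hle : AddCommGroup.primaryComponent W.sha p ≤ (W.sha)[m])
    (B₂ : AddCommGroup.primaryComponent W.sha p →+ AddCommGroup.primaryComponent W.sha p →+
      AddCircle (1 : ℚ))
    (hB₂ : ∀ a b, B₂ a b = ctLevelPairing W m e hμ hadd₁ hadd₂ hgal inv halt hPT' hH3 hfin
      ⟨a, hle a.2⟩ ⟨b, hle b.2⟩)
    (ι₂ : selmerGroup W ((m * m : ℕ) : ℤ) →+ AddCommGroup.primaryComponent W.sha p)
    (hι₂ : ∀ z, (((ι₂ z : AddCommGroup.primaryComponent W.sha p) : W.sha) : W.galH1) =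
      torsionH1ToH1 W ((m * m : ℕ) : ℤ) z) :
    ∃ ι : selmerGroup W ((m * m : ℕ) : ℤ) →+ (W.sha)[m],
      (∀ z, shaTorsionVal W m (ι z) = torsionH1ToH1 W ((m * m : ℕ) : ℤ) z) ∧
      (∀ z, ι z = ⟨ι₂ z, hle (ι₂ z).2⟩) ∧
      ∀ z t, B₂ (ι₂ z) (ι₂ t) =
        ctLevelPairing W m e hμ hadd₁ hadd₂ hgal inv halt hPT' hH3 hfin (ι z) (ι t) :=
  ⟨(AddSubgroup.inclusion hle).comp ι₂, fun z ↦ hι₂ z, fun _ ↦ rfl, fun _ _ ↦ hB₂ _ _⟩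

end Sha

end Literature.NumberTheory.EllipticCurves

end
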